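import Literature.NumberTheory.EllipticCurves.IwasawaTwistModPk
import Literature.NumberTheory.EllipticCurves.IwasawaTwistModPDual
import Literature.NumberTheory.EllipticCurves.KummerImageIsotropy
import HarnessLib

/-!
# The Gorenstein (convolution) pairing of the level-`p^k` Iwasawa twists
# `𝒯_J^{(k)}(ρ, κ) × 𝒯_J^{(k')}(ρ′, κ⁻¹) → P`, the transfer of scalars `⟨c x, y⟩ = ⟨x, c y⟩`, the change
# of coefficients, and the elliptic instantiation with a `μ_{p^k}`-valued Weil pairing on `E[p^k]`
# (definitions + proofs; no named fact)

Topic `NumberTheory/EllipticCurves` (sequel of `IwasawaTwistModPk` and of the model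
`IwasawaTwistModPDual`); namespaces `Literature.NumberTheory.EllipticCurves` (pure algebra),
`….ZpExtension`, `WeierstrassCurve`.  Cell `bsd-f3-mu` (crux `KatoDivisibilityX9` = item
stmt-BirchSwinnertonDyer-20547, line `graded_euler_loss`, stub `stub_depthX9`), typing ask **T-es-6 (d)**
(definition item `defn-ZpExtension.convCoeffPk`, a CHECK-FIRST item): the level-`p^k` local pairing
coefficients.  CHECK-FIRST OUTCOME: the model's convolution package (`coeffFun`, `convCoeff`,
`convCoeffHom`, `convCoeff_*_shiftEnd_*` (shift adjunction / vanishing above the diagonal),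
`convCoeff_unipotentPow_comm`, `gorensteinPairing`, `gorensteinPairing_right_nondegenerate/_surjective`)
is GENERIC in `(M, M′, P, e)` and applies verbatim to the level-`p^k` carriers `Fin J → M`; so this is
the SHORT instantiation file.  What is level-specific and is supplied here:

* (pure algebra, generic) `convCoeff_map₂` / `gorensteinPairing_map₂` — change of coefficients along
  maps `f : M → N`, `f′ : M′ → N′`, `g : P → Q` intertwining two pairings (`e₂ (f m) (f′ m′) = g (e m m′)`):
  `C_k(f∘x, f′∘y) = g (C_k(x, y))` (heterogeneous twin of the model's `convCoeff_map`) — item (iii), the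
  compatibility of the level-`p^k` coefficients with the level-`p` ones under ANY compatible triple
  (e.g. reduction `E[p^k] → E[p]` with `μ_{p^k} → μ_p`; the Weil-pairing compatibility itself is the
  consumer's hypothesis `he`, not asserted here);
  `convCoeff_nsmul_left/right`, **`convCoeff_nsmul_left_eq_right`**, `gorensteinPairing_nsmul_left_eq_right`
  — item (ii), the transfer of `p^d`: `⟨c • x, y⟩ = ⟨x, c • y⟩` (bi-additivity; MEMO-es §15 STEP 4).
* (level `p^k`, namespace `ZpExtension`) **`gorensteinPairing_twistModPk_smul`** — `B(g·x, g·y) = g·B(x, y)`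
  for the actions of `κ.twistModPk ρ hM J` (`p^k • M = 0`) and `κ⁻¹.twistModPk ρ′ hM′ J` (`p^{k'} • M′ = 0`)
  (both exponents read at the common admissible level `J + k + k'`, where they cancel modulo the order of
  `1+S`: `prime_pow_dvd_twistExponent_add_invTwist` + `unipotentPow_eq_one_of_dvd_of_pow_smul`);
  `twistContPairingPk` (tree `DiscreteGaloisModule.pairing`, input of `ContPairing.cupProduct` and of the
  Poitou–Tate local terms), **`twistDualMapPk : 𝒯_J^{(k')}(ρ′, κ⁻¹) →ⁱ (𝒯_J^{(k)}(ρ, κ))^D`** with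
  `_injective` / `_surjective` / `_bijective` under right-non-degeneracy / right-surjectivity of `e` —
  item (i).
* (elliptic curves) `muValuedPairingHom` (any biadditive function with values `n`-th roots of unity, as
  `A →+ B →+ MuCarrier F n`; the tree's `weilPairingHom` is the case `A = B = E[n]`),
  `WeierstrassCurve.geomTorsionPowCongr W p k : E[(p:ℤ)^k] ≃+ E[↑(p^k)]` (the two spellings of `E[p^k]` in
  the tree: Kato's reductions use `(p : ℤ) ^ k`, the Weil-pairing facts use `((p ^ k : ℕ) : ℤ)`), and
  **`WeierstrassCurve.modPkTwistContPairing`** — the equivariant pairing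
  `𝒯_J^{(k)}(E) × 𝒯_J^{(k)}(E)(κ⁻¹) → μ_{p^k}` attached to ANY `Γ`-equivariant biadditive `μ_{p^k}`-valued
  `e` on `E[p^k]` (e.g. a Weil pairing from `WeierstrassCurve.exists_weilPairing W (p ^ k)`).

References: B. Mazur, K. Rubin, *Kolyvagin systems*, Mem. AMS 799 (2004) §1.3, §5.3 [MazurRubin2004];
B. Howard, Compositio 140 (2004) Prop. 3.2.4 (`e_Λ(λt, a) = e_Λ(t, λ^ι a)`) [Howard2004HeegnerKolyvagin];
J. S. Milne, *Arithmetic Duality Theorems* (2006) I §0 [MilneADT2006]; J. H. Silverman, *AEC* III §8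
(Weil pairing) [SilvermanAEC2009]; cell bsd-f3-mu MEMO-es §15 STEPS 2–4, §25.3.
-/

noncomputable section

open scoped ContRepresentation
open Field Finset

universe u

namespace Literature.NumberTheory.EllipticCurves

open Literature.NumberTheory.GaloisRepresentations
open Literature.NumberTheory.GaloisRepresentations.DiscreteGaloisModule (pairing TateDual tateDual
  pairingDualIntertwining mu MuCarrier)

/-! ## Change of coefficients and transfer of scalars for the convolution coefficients (generic) -/

section Convolution

variable {M M' P : Type*} [AddCommGroup M] [AddCommGroup M'] [AddCommGroup P]
  (e : M →+ M' →+ P) (J : ℕ)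

/-- **Change of coefficients** (heterogeneous form of `convCoeff_map`): for additive `f : M → N`,
`f′ : M′ → N′`, `g : P → Q` with `e₂ (f m) (f′ m′) = g (e m m′)`, `C_k(f∘x, f′∘y) = g (C_k(x, y))`.  With
`f = f′ =` a reduction `E[p^k] → E[p]`-type map and `g : μ_{p^k} → μ_p` this is the compatibility of the
level-`p^k` coefficients with the level-`p` ones. [cite: MilneADT2006, Ch. I §0] -/
theorem convCoeff_map₂ {N N' Q : Type*} [AddCommGroup N] [AddCommGroup N'] [AddCommGroup Q]
    {e₂ : N →+ N' →+ Q} (f : M →+ N) (f' : M' →+ N') (g : P →+ Q)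
    (he : ∀ m m', e₂ (f m) (f' m') = g (e m m')) (k : ℕ) (x : Fin J → M) (y : Fin J → M') :
    convCoeff e₂ J k (fun i => f (x i)) (fun i => f' (y i)) = g (convCoeff e J k x y) := by
  rw [convCoeff_def, convCoeff_def, map_sum]
  refine sum_congr rfl fun a _ => ?_
  rw [coeffFun_map, coeffFun_map, he]

/-- Change of coefficients for the Gorenstein pairing (top coefficient). [cite: MilneADT2006, Ch. I §0] -/
theorem gorensteinPairing_map₂ {N N' Q : Type*} [AddCommGroup N] [AddCommGroup N'] [AddCommGroup Q]
    {e₂ : N →+ N' →+ Q} (f : M →+ N) (f' : M' →+ N') (g : P →+ Q)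
    (he : ∀ m m', e₂ (f m) (f' m') = g (e m m')) (x : Fin J → M) (y : Fin J → M') :
    gorensteinPairing e₂ J (fun i => f (x i)) (fun i => f' (y i)) = g (gorensteinPairing e J x y) := by
  rw [gorensteinPairing_apply, gorensteinPairing_apply]
  exact convCoeff_map₂ e J f f' g he _ x y

/-- `C_k(x, c • y) = c • C_k(x, y)` (`c ∈ ℕ`). [cite: MazurRubin2004, §1.3 and §5.3] -/
theorem convCoeff_nsmul_right (c : ℕ) (k : ℕ) (x : Fin J → M) (y : Fin J → M') :
    convCoeff e J k x (c • y) = c • convCoeff e J k x y := by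
  rw [← convCoeffHom_apply, map_nsmul, convCoeffHom_apply]

/-- `C_k(c • x, y) = c • C_k(x, y)` (`c ∈ ℕ`). [cite: MazurRubin2004, §1.3 and §5.3] -/
theorem convCoeff_nsmul_left (c : ℕ) (k : ℕ) (x : Fin J → M) (y : Fin J → M') :
    convCoeff e J k (c • x) y = c • convCoeff e J k x y := by
  rw [← convCoeffHom_apply, ← AddMonoidHom.flip_apply (convCoeffHom e J k), map_nsmul,
    AddMonoidHom.flip_apply, convCoeffHom_apply]

/-- **Transfer of scalars `⟨c x, y⟩ = ⟨x, c y⟩`** (e.g. `c = p^d`, MEMO-es §15 STEP 4: the power of `p`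
dividing the Euler-system side is moved to the test side). [cite: Howard2004HeegnerKolyvagin, Prop. 3.2.4] -/
theorem convCoeff_nsmul_left_eq_right (c : ℕ) (k : ℕ) (x : Fin J → M) (y : Fin J → M') :
    convCoeff e J k (c • x) y = convCoeff e J k x (c • y) := by
  rw [convCoeff_nsmul_left, convCoeff_nsmul_right]

/-- Transfer of scalars for the Gorenstein pairing: `B(c x, y) = B(x, c y)`.
[cite: Howard2004HeegnerKolyvagin, Prop. 3.2.4] -/
theorem gorensteinPairing_nsmul_left_eq_right (c : ℕ) (x : Fin J → M) (y : Fin J → M') :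
    gorensteinPairing e J (c • x) y = gorensteinPairing e J x (c • y) := by
  rw [gorensteinPairing_apply, gorensteinPairing_apply, convCoeff_nsmul_left_eq_right]

end Convolution

/-! ## A `μₙ`-valued biadditive function as a pairing `A →+ B →+ μₙ` (generic form of `weilPairingHom`) -/

section MuValued

variable {F : Type u} [Field F] (n : ℕ) [NeZero n] {A B : Type*} [AddCommGroup A] [AddCommGroup B]
  (e : A → B → AlgebraicClosure F) (hμ : ∀ a b, e a b ^ n = 1)
  (hadd₁ : ∀ a₁ a₂ b, e (a₁ + a₂) b = e a₁ b * e a₂ b)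
  (hadd₂ : ∀ a b₁ b₂, e a (b₁ + b₂) = e a b₁ * e a b₂)

/-- **A biadditive function with values `n`-th roots of unity, as `A →+ B →+ μₙ`** (roots of unity written
additively in `MuCarrier F n`; the tree's `weilPairingHom W n` is the case `A = B = E[n]`).  Used to feed a
Weil pairing given on ANY spelling of `E[p^k]`. [cite: SilvermanAEC2009, III.§8 (Prop. 8.1 (a))] -/
def muValuedPairingHom : A →+ B →+ MuCarrier F n :=
  AddMonoidHom.mk' (fun a ↦ AddMonoidHom.mk'
      (fun b ↦ MuCarrier.ofRootsOfUnity (rootsOfUnity.mkOfPowEq (e a b) (hμ a b)))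
      fun b₁ b₂ ↦ by
        rw [muCarrier_eq_iff]
        change e a (b₁ + b₂) = e a b₁ * e a b₂
        exact hadd₂ a b₁ b₂)
    fun a₁ a₂ ↦ by
      ext b
      rw [AddMonoidHom.mk'_apply, AddMonoidHom.add_apply, AddMonoidHom.mk'_apply,
        AddMonoidHom.mk'_apply, muCarrier_eq_iff]
      change e (a₁ + a₂) b = e a₁ b * e a₂ b
      exact hadd₁ a₁ a₂ b

/-- Unfolding `muValuedPairingHom` on underlying elements of `F̄`. [cite: SilvermanAEC2009, III.§8 (Prop. 8.1 (a))] -/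
@[simp] theorem coe_muValuedPairingHom (a : A) (b : B) :
    (((MuCarrier.toAdditive (muValuedPairingHom n e hμ hadd₁ hadd₂ a b)).toMul :
      (AlgebraicClosure F)ˣ) : AlgebraicClosure F) = e a b := rfl

end MuValued

/-! ## The Gorenstein pairing of the level-`p^k` twists is `Γ_K`-equivariant -/

namespace ZpExtension

variable {K : Type u} [Field K] {p : ℕ} [Fact p.Prime] (κ : ZpExtension K p)

variable {M M' P : Type u} [AddCommGroup M] [TopologicalSpace M] [DiscreteTopology M]
  [AddCommGroup M'] [TopologicalSpace M'] [DiscreteTopology M']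
  [AddCommGroup P] [TopologicalSpace P] [DiscreteTopology P]
  (ρ : DiscreteGaloisModule K M) (ρ' : DiscreteGaloisModule K M') (ρP : DiscreteGaloisModule K P)
  {k k' : ℕ} (hM : ∀ x : M, p ^ k • x = 0) (hM' : ∀ x : M', p ^ k' • x = 0) (J : ℕ)
  {e : M →+ M' →+ P}
  (he : ∀ (g : absoluteGaloisGroup K) (m : M) (m' : M'), e (ρ g m) (ρ' g m') = ρP g (e m m'))

/-- Admissible levels: `J ≤ p^N` as soon as `J ≤ N`; private helper. [folklore] -/
private theorem le_prime_pow_of_le'' {J N : ℕ} (h : J ≤ N) : J ≤ p ^ N :=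
  h.trans (Nat.lt_pow_self (Fact.out : p.Prime).one_lt).le

include he in
/-- **The Gorenstein pairing is `Γ_K`-equivariant for the level-`p^k` twists
`𝒯_J^{(k)}(ρ, κ) × 𝒯_J^{(k')}(ρ′, κ⁻¹) → P`**: `B(g·x, g·y) = g·B(x, y)`, where `g` acts on `x` by
`(1+S)^{κ(g)} ∘ ρ(g)` and on `y` by `(1+S)^{−κ(g)} ∘ ρ′(g)` — both exponents read at the common admissible
level `N = J + k + k'` (`twistModPk_apply_of_level`), where the unipotent parts cancel because `(1+S)` is
self-adjoint for `B` (`gorensteinPairing_unipotentPow_comm`) and `p^N ∣ e_N(g) + e_N^{κ⁻¹}(g)` kills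
`(1+S)` on the `p^{k'}`-torsion side (`unipotentPow_eq_one_of_dvd_of_pow_smul`).  The dual deformation
carries `χ⁻¹`. [cite: Howard2004HeegnerKolyvagin, Prop. 3.2.4] [cite: MazurRubin2004, §1.3 and §5.3] -/
theorem gorensteinPairing_twistModPk_smul (g : absoluteGaloisGroup K) (x : Fin J → M) (y : Fin J → M') :
    gorensteinPairing e J (κ.twistModPk ρ hM J g x) (κ.invTwist.twistModPk ρ' hM' J g y) =
      ρP g (gorensteinPairing e J x y) := by
  rw [κ.twistModPk_apply_of_level ρ hM J (N := J + k + k') (le_prime_pow_of_le'' (by omega)) g x,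
    κ.invTwist.twistModPk_apply_of_level ρ' hM' J (N := J + k + k') (le_prime_pow_of_le'' (by omega)) g y,
    gorensteinPairing_unipotentPow_comm, ← Module.End.mul_apply, ← unipotentPow_add,
    unipotentPow_eq_one_of_dvd_of_pow_smul hM' (m := J + k + k') (le_prime_pow_of_le'' (by omega))
      (κ.prime_pow_dvd_twistExponent_add_invTwist (J + k + k') g),
    Module.End.one_apply, gorensteinPairing_apply, gorensteinPairing_apply]
  exact convCoeff_map e (f := (ρ g : M →ₗ[ℤ] M).toAddMonoidHom) (f' := (ρ' g : M' →ₗ[ℤ] M').toAddMonoidHom)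
    (g := (ρP g : P →ₗ[ℤ] P).toAddMonoidHom) (fun m m' => he g m m') _ x y

/-- **The Gorenstein pairing as a continuous `Γ_K`-equivariant pairing of the level-`p^k` twists**
`𝒯_J^{(k)}(ρ, κ) × 𝒯_J^{(k')}(ρ′, κ⁻¹) → P` (tree `DiscreteGaloisModule.pairing`; feeds `ContPairing.cupProduct`,
`cupProduct_pairing_eq_tateDualPairing` and the Poitou–Tate local terms). [cite: MazurRubin2004, §1.3 and §5.3] -/
def twistContPairingPk :
    ContPairing (κ.twistModPk ρ hM J).toTopRep (κ.invTwist.twistModPk ρ' hM' J).toTopRep ρP.toTopRep :=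
  pairing (κ.twistModPk ρ hM J) (κ.invTwist.twistModPk ρ' hM' J) ρP (gorensteinPairing e J)
    (κ.gorensteinPairing_twistModPk_smul ρ ρ' ρP hM hM' J he)

/-- Unfolding lemma for `twistContPairingPk`. [cite: MazurRubin2004, §1.3 and §5.3] -/
@[simp] theorem twistContPairingPk_toLin_apply (x : Fin J → M) (y : Fin J → M') :
    (κ.twistContPairingPk ρ ρ' ρP hM hM' J he).toLin x y = gorensteinPairing e J x y := rfl

end ZpExtension

/-! ## The Tate dual of a level-`p^k` twist: `𝒯_J^{(k')}(ρ′, κ⁻¹) → (𝒯_J^{(k)}(ρ, κ))^D` -/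

namespace ZpExtension

variable {K : Type u} [Field K] {p : ℕ} [Fact p.Prime] (κ : ZpExtension K p)
  {M M' : Type u} [AddCommGroup M] [TopologicalSpace M] [DiscreteTopology M] [Finite M]
  [AddCommGroup M'] [TopologicalSpace M'] [DiscreteTopology M']
  (ρ : DiscreteGaloisModule K M) (ρ' : DiscreteGaloisModule K M') (n : ℕ)
  {k k' : ℕ} (hM : ∀ x : M, p ^ k • x = 0) (hM' : ∀ x : M', p ^ k' • x = 0) (J : ℕ)
  {e : M →+ M' →+ DiscreteGaloisModule.MuCarrier K n}
  (he : ∀ (g : absoluteGaloisGroup K) (m : M) (m' : M'),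
    e (ρ g m) (ρ' g m') = DiscreteGaloisModule.mu K n g (e m m'))

/-- **The dual map `𝒯_J^{(k')}(ρ′, κ⁻¹) → 𝒯_J^{(k)}(ρ, κ)^D = Hom(𝒯_J^{(k)}(ρ, κ), μ_n)`, `y ↦ B(·, y)`**, a
continuous `Γ_K`-equivariant map into the tree's Tate dual (action `(σf)(x) = σ f(σ⁻¹ x)`), via
`pairingDualIntertwining`.  For `M = M′ = E[p^k]`, `e` the Weil pairing, `n = p^k`:
`E[p^k] ⊗ A_J^{(k)}(χ⁻¹) → (𝒯_J^{(k)})^*`. [cite: MazurRubin2004, §1.3 and §5.3] [cite: MilneADT2006, Ch. I §0] -/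
def twistDualMapPk :
    (κ.invTwist.twistModPk ρ' hM' J).toContRepresentation →ⁱL
      ((κ.twistModPk ρ hM J).tateDual n).toContRepresentation :=
  pairingDualIntertwining (ρ₁ := κ.twistModPk ρ hM J) (ρ₂ := κ.invTwist.twistModPk ρ' hM' J) (n := n)
    (B := gorensteinPairing e J)
    (κ.gorensteinPairing_twistModPk_smul ρ ρ' (DiscreteGaloisModule.mu K n) hM hM' J he)

/-- Unfolding lemma: `twistDualMapPk y x = B(x, y)`. [cite: MazurRubin2004, §1.3 and §5.3] -/
@[simp] theorem twistDualMapPk_apply_apply (y : Fin J → M') (x : Fin J → M) :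
    κ.twistDualMapPk ρ ρ' n hM hM' J he y x = gorensteinPairing e J x y := rfl

/-- **`twistDualMapPk` is injective** when `e` is right-non-degenerate. [cite: MilneADT2006, Ch. I §0] -/
theorem twistDualMapPk_injective (hnd : ∀ m', (∀ m, e m m' = 0) → m' = 0) :
    Function.Injective (κ.twistDualMapPk ρ ρ' n hM hM' J he) := by
  refine (injective_iff_map_eq_zero _).2 fun y hy => ?_
  exact gorensteinPairing_right_nondegenerate e hnd y fun x => by
    rw [← twistDualMapPk_apply_apply κ ρ ρ' n hM hM' J he, hy]; rfl

/-- **`twistDualMapPk` is surjective** when `e` is right-surjective onto `Hom(M, μ_n)`.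
[cite: MilneADT2006, Ch. I §0] -/
theorem twistDualMapPk_surjective
    (hsurj : ∀ φ : M →+ DiscreteGaloisModule.MuCarrier K n, ∃ m', ∀ m, e m m' = φ m) :
    Function.Surjective (κ.twistDualMapPk ρ ρ' n hM hM' J he) := by
  intro f
  obtain ⟨y, hy⟩ := gorensteinPairing_right_surjective e hsurj
    (f : (Fin J → M) →+ DiscreteGaloisModule.MuCarrier K n)
  exact ⟨y, TateDual.ext fun x => by rw [twistDualMapPk_apply_apply, hy]; rfl⟩

/-- **`𝒯_J^{(k')}(ρ′, κ⁻¹) ≅ 𝒯_J^{(k)}(ρ, κ)^D`** when `e : M × M′ → μ_n` is perfect on the right.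
[cite: MazurRubin2004, §1.3 and §5.3] [cite: MilneADT2006, Ch. I §0] -/
theorem twistDualMapPk_bijective (hnd : ∀ m', (∀ m, e m m' = 0) → m' = 0)
    (hsurj : ∀ φ : M →+ DiscreteGaloisModule.MuCarrier K n, ∃ m', ∀ m, e m m' = φ m) :
    Function.Bijective (κ.twistDualMapPk ρ ρ' n hM hM' J he) :=
  ⟨κ.twistDualMapPk_injective ρ ρ' n hM hM' J he hnd, κ.twistDualMapPk_surjective ρ ρ' n hM hM' J he hsurj⟩

end ZpExtension

end Literature.NumberTheory.EllipticCurves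

/-! ## Elliptic curves: a `μ_{p^k}`-valued pairing on `E[p^k]` and the pairing of the twists `𝒯_J^{(k)}(E)` -/

namespace WeierstrassCurve

open Literature.NumberTheory.EllipticCurves Literature.NumberTheory.GaloisRepresentations
open Literature.NumberTheory.GaloisRepresentations.DiscreteGaloisModule (mu MuCarrier)

variable {F : Type u} [Field F] (W : WeierstrassCurve F) (p : ℕ) [Fact p.Prime] (k : ℕ)

omit [Fact p.Prime] in
/-- The two spellings of `E[p^k]` in the tree agree: `E[(p : ℤ) ^ k] = E[((p ^ k : ℕ) : ℤ)]` as subgroups of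
`E(F̄)` (`Nat.cast_pow`). [cite: SilvermanAEC2009, III.§4 (Definition of E[m])] -/
theorem geomTorsion_pow_eq : geomTorsion W ((p : ℤ) ^ k) = geomTorsion W ((p ^ k : ℕ) : ℤ) := by
  rw [Nat.cast_pow]

/-- **`E[(p : ℤ) ^ k] ≃+ E[↑(p ^ k)]`**, the identity on points between the two spellings of `E[p^k]`
(Kato-side reductions `tateModPk`/`reduceH1Pk` use `(p : ℤ) ^ k`; the tree's Weil-pairing facts
`exists_weilPairing W (p ^ k)` use the cast of `p ^ k : ℕ`). [cite: SilvermanAEC2009, III.§4 (Definition of E[m])] -/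
def geomTorsionPowCongr : geomTorsion W ((p : ℤ) ^ k) ≃+ geomTorsion W ((p ^ k : ℕ) : ℤ) :=
  AddEquiv.addSubgroupCongr (W.geomTorsion_pow_eq p k)

omit [Fact p.Prime] in
/-- `geomTorsionPowCongr` is the identity on underlying points. [cite: SilvermanAEC2009, III.§4 (Definition of E[m])] -/
@[simp] theorem coe_geomTorsionPowCongr (P : geomTorsion W ((p : ℤ) ^ k)) :
    ((W.geomTorsionPowCongr p k P : geomTorsion W ((p ^ k : ℕ) : ℤ)) : geomPoints W) = P := rfl

omit [Fact p.Prime] in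
/-- `geomTorsionPowCongr` is `Γ_F`-equivariant. [cite: SilvermanAEC2009, III.§8 (Prop. 8.1)] -/
theorem geomTorsionPowCongr_smul (σ : absoluteGaloisGroup F) (P : geomTorsion W ((p : ℤ) ^ k)) :
    W.geomTorsionPowCongr p k (σ • P) = σ • W.geomTorsionPowCongr p k P :=
  Subtype.ext rfl

section WeilPairing

variable (e : geomTorsion W ((p ^ k : ℕ) : ℤ) → geomTorsion W ((p ^ k : ℕ) : ℤ) → AlgebraicClosure F)
  (hμ : ∀ S T, e S T ^ (p ^ k) = 1)
  (hadd₁ : ∀ S₁ S₂ T, e (S₁ + S₂) T = e S₁ T * e S₂ T)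
  (hadd₂ : ∀ S T₁ T₂, e S (T₁ + T₂) = e S T₁ * e S T₂)
  (hgal : ∀ (σ : absoluteGaloisGroup F) (S T : geomTorsion W ((p ^ k : ℕ) : ℤ)),
    σ • e S T = e (σ • S) (σ • T))

/-- `p ^ k ≠ 0`, the `NeZero` instance the `μ_{p^k}`-constructions need. [folklore] -/
private theorem neZero_pow : NeZero (p ^ k) := ⟨pow_ne_zero _ (Fact.out : p.Prime).ne_zero⟩

/-- **A biadditive `μ_{p^k}`-valued pairing `e` on `E[p^k]` (e.g. a Weil pairing of
`exists_weilPairing W (p ^ k)`), transported to the spelling `E[(p : ℤ) ^ k]` of the level-`p^k` twists**: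
`E[(p:ℤ)^k] →+ E[(p:ℤ)^k] →+ μ_{p^k}` (`muValuedPairingHom` after `geomTorsionPowCongr`).
[cite: SilvermanAEC2009, III.§8 (Prop. 8.1)] -/
def powWeilPairingHom :
    geomTorsion W ((p : ℤ) ^ k) →+ geomTorsion W ((p : ℤ) ^ k) →+ MuCarrier F (p ^ k) :=
  haveI := neZero_pow p k
  muValuedPairingHom (p ^ k)
    (fun S T ↦ e (W.geomTorsionPowCongr p k S) (W.geomTorsionPowCongr p k T))
    (fun S T ↦ hμ _ _) (fun S₁ S₂ T ↦ by rw [map_add, hadd₁]) (fun S T₁ T₂ ↦ by rw [map_add, hadd₂])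

/-- Unfolding `powWeilPairingHom` on underlying elements of `F̄`. [cite: SilvermanAEC2009, III.§8 (Prop. 8.1)] -/
@[simp] theorem coe_powWeilPairingHom (S T : geomTorsion W ((p : ℤ) ^ k)) :
    (((MuCarrier.toAdditive (W.powWeilPairingHom p k e hμ hadd₁ hadd₂ S T)).toMul :
      (AlgebraicClosure F)ˣ) : AlgebraicClosure F) =
      e (W.geomTorsionPowCongr p k S) (W.geomTorsionPowCongr p k T) := rfl

include hgal in
/-- `powWeilPairingHom` is `Γ_F`-equivariant into `μ_{p^k}` (Silverman III.8.1 (d)): the hypothesis `he`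
of the twist pairings. [cite: SilvermanAEC2009, III.§8 (Prop. 8.1 (d))] -/
theorem powWeilPairingHom_smul (σ : absoluteGaloisGroup F) (S T : geomTorsion W ((p : ℤ) ^ k)) :
    W.powWeilPairingHom p k e hμ hadd₁ hadd₂ (W.torsionGaloisModule ((p : ℤ) ^ k) σ S)
        (W.torsionGaloisModule ((p : ℤ) ^ k) σ T) =
      mu F (p ^ k) σ (W.powWeilPairingHom p k e hμ hadd₁ hadd₂ S T) := by
  haveI := neZero_pow p k
  rw [muCarrier_eq_iff, torsionGaloisModule_apply_apply, torsionGaloisModule_apply_apply,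
    coe_powWeilPairingHom, DiscreteGaloisModule.mu_apply_apply, toMul_ofMul,
    absoluteGaloisGroup.coe_smul_rootsOfUnity, Units.coe_smul, coe_powWeilPairingHom,
    geomTorsionPowCongr_smul, geomTorsionPowCongr_smul]
  exact (hgal σ _ _).symm

variable (κ : ZpExtension F p) (J : ℕ)

/-- **The Gorenstein pairing of the level-`p^k` twists of an elliptic curve**,
`𝒯_J^{(k)}(E)(κ) × 𝒯_J^{(k)}(E)(κ⁻¹) → μ_{p^k}` — `B(x, y) = Σ_{i+j=J−1} e(x_i, y_j)` for a `Γ`-equivariant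
biadditive `μ_{p^k}`-valued `e` on `E[p^k]` — as a continuous `Γ_F`-equivariant pairing
(`ZpExtension.twistContPairingPk` on `W.modPkTwist p k κ J = κ.twistModPk E[p^k]` and the `κ⁻¹`-twist), the
input of the cup product / Poitou–Tate local terms of MEMO-es §15 STEPS 2–4 at level `p^k`.
[cite: MazurRubin2004, §1.3 and §5.3] [cite: SilvermanAEC2009, III.§8 (Prop. 8.1)] -/
def modPkTwistContPairing :
    ContPairing (W.modPkTwist p k κ J).toTopRep
      (κ.invTwist.twistModPk (W.torsionGaloisModule ((p : ℤ) ^ k)) (W.pow_nsmul_geomTorsion_eq_zero p k)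
        J).toTopRep
      (mu F (p ^ k)).toTopRep :=
  κ.twistContPairingPk (W.torsionGaloisModule ((p : ℤ) ^ k)) (W.torsionGaloisModule ((p : ℤ) ^ k))
    (mu F (p ^ k)) (W.pow_nsmul_geomTorsion_eq_zero p k) (W.pow_nsmul_geomTorsion_eq_zero p k) J
    (e := W.powWeilPairingHom p k e hμ hadd₁ hadd₂) (W.powWeilPairingHom_smul p k e hμ hadd₁ hadd₂ hgal)

/-- Unfolding `modPkTwistContPairing`: its bilinear map is the Gorenstein pairing of `powWeilPairingHom`.
[cite: MazurRubin2004, §1.3 and §5.3] -/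
@[simp] theorem modPkTwistContPairing_toLin_apply (x y : Fin J → geomTorsion W ((p : ℤ) ^ k)) :
    (W.modPkTwistContPairing p k e hμ hadd₁ hadd₂ hgal κ J).toLin x y =
      gorensteinPairing (W.powWeilPairingHom p k e hμ hadd₁ hadd₂) J x y := rfl

end WeilPairing

end WeierstrassCurve

end
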